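import Summits.Ventures.PercRepro.Night2ThreeTwoMissedCol

/-!
# PercRepro — the cell `(3, 2)`: the three kinds of missed-point sources and the weighted load bound (night-2, gen 25)

A source of a target of the missed-point routing (`Night2ThreeTwoMissedSources`) is a big thin member `B ⊆ S` with
`S ∖ B` a pair of points missed by `B`.  Its contribution to `dload S` depends on the number `m = |G ∖ cl B|` of points
it misses: a source missing `m ≥ 4` points loses nothing (its covering sets are unsaturated: `Φ/7 + 7/30 = 2/5 < 5/12`),
one missing three contributes at most `2·(1/198)/2 = 1/198`, a fat one (`m = 2`) at most `2·(1/40) = 1/20`.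

* `loss_eq_zero_of_big_four_le`, `source_sum_eq_zero_of_four_le`, `source_sum_le_of_three`: the three kinds;
* **`dload_missed_le_weighted`**: `dload S ≤ #{fat sources}/20 + #{sources missing three points}/198`.
The global common-line argument of `Night2ThreeTwoMissedGlobal` bounds the two counts by `3` and `4`.
-/

namespace PercRepro.Shadow

open Finset PerFlat ThmH

variable {α : Type*} [DecidableEq α] {M : Matroid α} [M.Finite]

section Kinds

variable {G : Finset α}

/-- In the cell `(3, 2)` a big thin pair missing at least four points loses nothing: its covering set is unsaturated. -/
theorem loss_eq_zero_of_big_four_le (hG : G ∈ flatsQ M (5 + 1)) (hd : (gr M \ G).card = 3) (hk : kColoops M G = 2)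
    (hs : ∀ e ∈ gr M, ∀ f ∈ gr M, e ≠ f → rkN M {e, f} = 2) (hl : ∀ e ∈ gr M, M.Indep {e}) {B : Finset α}
    (hB : B ∈ thinMembers M 5 G) (hbig : 4 ≤ (B \ coloops M G).card) (hm4 : 4 ≤ (G \ clF M B).card) {z : α}
    (hz : z ∈ G \ clF M B) : loss M 5 G B z = 0 := by
  have hd' : (gr M \ G).card ≤ 5 := by omega
  have hQ := insert_mem_shadowAt_thin hG hB hz
  have hQcard : 4 + 1 ≤ (insert z B \ coloops M G).card := by
    rw [card_insert_sdiff_coloops_thin hG hd' hB hz]; omega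
  have hL1 := L1_le_req_add_of_three_two hG hd hk hs hl hQ hQcard (mem_thin_coverPreimages_insert hB hz)
  have hcap := capS_ge_five_twelfths_three_two hd hk (subset_G_of_mem_shadowAt hQ)
  have hreq : req M 5 B ≤ 1 / 6 := by
    rw [req_eq_of_thin hG hB, hd]
    have h4 : (4 : ℚ) ≤ ((G \ clF M B).card : ℚ) := by exact_mod_cast hm4
    unfold phiQ
    push_cast
    rw [div_le_iff₀ (by linarith)]
    linarith
  exact loss_eq_zero_of_unsat (by linarith)

open scoped Classical in
/-- A source missing at least four points contributes nothing. -/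
theorem source_sum_eq_zero_of_four_le (hG : G ∈ flatsQ M (5 + 1)) (hd : (gr M \ G).card = 3)
    (hk : kColoops M G = 2) (hs : ∀ e ∈ gr M, ∀ f ∈ gr M, e ≠ f → rkN M {e, f} = 2) (hl : ∀ e ∈ gr M, M.Indep {e})
    {P : Finset α → Prop} [DecidablePred P] (hP : ∀ B, P B → 4 ≤ (B \ coloops M G).card) {S B : Finset α}
    (hB : B ∈ missedSources M 5 G P S) (hm4 : 4 ≤ (G \ clF M B).card) :
    ∑ z ∈ S \ B, loss M 5 G B z / (((G \ clF M B).card : ℚ) - 1) = 0 := by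
  obtain ⟨⟨hthin, hPB⟩, -, -, hsub⟩ := mem_missedSources.1 hB
  apply Finset.sum_eq_zero
  intro z hz
  rw [loss_eq_zero_of_big_four_le hG hd hk hs hl hthin (hP B hPB) hm4 (hsub hz), zero_div]

open scoped Classical in
/-- A source missing exactly three points contributes at most `1/198`. -/
theorem source_sum_le_of_three (hG : G ∈ flatsQ M (5 + 1)) (hd : (gr M \ G).card = 3) (hk : kColoops M G = 2)
    (hs : ∀ e ∈ gr M, ∀ f ∈ gr M, e ≠ f → rkN M {e, f} = 2) (hl : ∀ e ∈ gr M, M.Indep {e})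
    {P : Finset α → Prop} [DecidablePred P] (hP : ∀ B, P B → 4 ≤ (B \ coloops M G).card) {S B : Finset α}
    (hB : B ∈ missedSources M 5 G P S) (hm3 : (G \ clF M B).card = 3) :
    ∑ z ∈ S \ B, loss M 5 G B z / (((G \ clF M B).card : ℚ) - 1) ≤ 1 / 198 := by
  obtain ⟨⟨hthin, hPB⟩, -, hc2, hsub⟩ := mem_missedSources.1 hB
  rw [hm3]
  calc ∑ z ∈ S \ B, loss M 5 G B z / (((3 : ℕ) : ℚ) - 1)
      ≤ ∑ _z ∈ S \ B, (1 / 198 : ℚ) / (((3 : ℕ) : ℚ) - 1) := by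
        apply Finset.sum_le_sum
        intro z hz
        exact div_le_div_of_nonneg_right
          (loss_le_of_big_three_two' hG hd hk hs hl hthin (hP B hPB) (by omega) (hsub hz)) (by norm_num)
    _ = 1 / 198 := by rw [Finset.sum_const, nsmul_eq_mul, hc2]; norm_num

open scoped Classical in
/-- **The weighted source bound**: `dload S ≤ #{fat sources}/20 + #{sources missing three points}/198`. -/
theorem dload_missed_le_weighted (hG : G ∈ flatsQ M (5 + 1)) (hd : (gr M \ G).card = 3) (hk : kColoops M G = 2)
    (hs : ∀ e ∈ gr M, ∀ f ∈ gr M, e ≠ f → rkN M {e, f} = 2) (hl : ∀ e ∈ gr M, M.Indep {e})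
    {P : Finset α → Prop} [DecidablePred P] (hP : ∀ B, P B → 4 ≤ (B \ coloops M G).card) (S : Finset α) :
    dload M 5 G P (dshMissed M 5 G) S ≤
      (((missedSources M 5 G P S).filter (fun B => (G \ clF M B).card = 2)).card : ℚ) * (1 / 20) +
      (((missedSources M 5 G P S).filter (fun B => (G \ clF M B).card = 3)).card : ℚ) * (1 / 198) := by
  have hd' : (gr M \ G).card ≤ 5 := by omega
  refine (dload_missed_le_sum_sources hG hd' S).trans ?_
  rw [← Finset.sum_filter_add_sum_filter_not (missedSources M 5 G P S) (fun B => (G \ clF M B).card = 2),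
    ← Finset.sum_filter_add_sum_filter_not ((missedSources M 5 G P S).filter (fun B => ¬ (G \ clF M B).card = 2))
      (fun B => (G \ clF M B).card = 3)]
  have h2 : ∑ B ∈ (missedSources M 5 G P S).filter (fun B => (G \ clF M B).card = 2),
      ∑ z ∈ S \ B, loss M 5 G B z / (((G \ clF M B).card : ℚ) - 1) ≤
      (((missedSources M 5 G P S).filter (fun B => (G \ clF M B).card = 2)).card : ℚ) * (1 / 20) := by
    rw [← nsmul_eq_mul, ← Finset.sum_const]
    apply Finset.sum_le_sum
    intro B hB
    exact source_sum_le_of_three_two hG hd hk hs hl hP (Finset.mem_filter.1 hB).1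
  have h3 : ∑ B ∈ ((missedSources M 5 G P S).filter (fun B => ¬ (G \ clF M B).card = 2)).filter
        (fun B => (G \ clF M B).card = 3),
      ∑ z ∈ S \ B, loss M 5 G B z / (((G \ clF M B).card : ℚ) - 1) ≤
      (((missedSources M 5 G P S).filter (fun B => (G \ clF M B).card = 3)).card : ℚ) * (1 / 198) := by
    rw [Finset.filter_filter]
    have heq : (missedSources M 5 G P S).filter (fun B => ¬ (G \ clF M B).card = 2 ∧ (G \ clF M B).card = 3) =
        (missedSources M 5 G P S).filter (fun B => (G \ clF M B).card = 3) := by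
      apply Finset.filter_congr
      intro B _
      constructor
      · exact fun h => h.2
      · exact fun h => ⟨by omega, h⟩
    rw [heq, ← nsmul_eq_mul, ← Finset.sum_const]
    apply Finset.sum_le_sum
    intro B hB
    exact source_sum_le_of_three hG hd hk hs hl hP (Finset.mem_filter.1 hB).1 (Finset.mem_filter.1 hB).2
  have h4 : ∑ B ∈ ((missedSources M 5 G P S).filter (fun B => ¬ (G \ clF M B).card = 2)).filter
        (fun B => ¬ (G \ clF M B).card = 3),
      ∑ z ∈ S \ B, loss M 5 G B z / (((G \ clF M B).card : ℚ) - 1) = 0 := by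
    apply Finset.sum_eq_zero
    intro B hB
    rw [Finset.mem_filter, Finset.mem_filter] at hB
    have hm2 : 2 ≤ (G \ clF M B).card :=
      two_le_card_sdiff_of_not_lay0 hG hd' (mem_thinMembers.1 (mem_missedSources.1 hB.1.1).1.1).1
        (mem_thinMembers.1 (mem_missedSources.1 hB.1.1).1.1).2
    exact source_sum_eq_zero_of_four_le hG hd hk hs hl hP hB.1.1 (by omega)
  linarith

end Kinds

end PercRepro.Shadow
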